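import Mathlib
import HarnessLib
import Summits.HubbardSuperconductivity.HubbardSuperconductivity.Theorems.KLProgrammeKLRegimeWickBubbleColourings
import Literature.MathematicalPhysics.QuantumLattice.GrassmannKernelExpansion
import Literature.MathematicalPhysics.QuantumLattice.GrassmannChargeScaling

/-!
# Route `KLProgramme` — ENGINE child gen 5 (stmt-HubbardSuperconductivity-19918 `KLRegimeEngineV14`), stub `stub_engine_step_values`,
# conjunct (E2-v9): the 4-leg kernel of the TWO-LINE (bubble) Wick term as the SUM OVER ALL SIXTEEN leg colourings
# (E2-WICK-ROADMAP §5 (iii-c) step 2, generic half, part 2; cell gate-hubbard-kl, seat p1 g9; sequel to `…WickBubbleColourings`)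

Part 1 evaluated the six `2+2` colourings of `kernel (Δ_×(C₁)(Δ_×(C₂)(a⁰·b¹))) 4 (Z, s)`.  Here:

* §2 the eight ODD colourings vanish when `b` is even: the sign flip `ψ(X,1) ↦ −ψ(X,1)` of the copy-`1` generators fixes `a⁰·b¹`
  (`b` even; `CliffordAlgebra.involute_eq_of_mem_even`) and multiplies a kernel with an odd number of copy-`1` legs by `−1`
  (`GrassmannChargeScaling.prod_mul_kernel_of_invariant`);
* §3 the two EXTREME colourings `(0,0,0,0)` / `(1,1,1,1)`: `−60·Σ contr C₂ X Y · contr C₁ X' Y' · kernel a 6 (X,X',Z) · kernel b 2 (Y,Y')` and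
  its mirror (`60 = 6!·2!/4!`) — the `𝒲₆ ⊗ 𝒲₂` graphs (two lines into a two-leg vertex);
* §4 **`kernel_dblFold_bubble`** — the sum of all sixteen (`kernel_dblFold`, `sum_colourings_four`): with
  `B(A₀A₁|B₀B₁) = Σ contr C₂ X Y · contr C₁ X' Y' · kernel a 4 (X,X',A₀,A₁) · kernel b 4 (Y,Y',B₀,B₁)`,
  `kernel (dblFold(Δ_×(C₁)Δ_×(C₂)(a⁰b¹))) 4 Z = −4!·(B(Z₂Z₃|Z₀Z₁) + B(Z₀Z₁|Z₂Z₃) + B(Z₀Z₃|Z₁Z₂) + B(Z₁Z₂|Z₀Z₃) − B(Z₀Z₂|Z₁Z₃) − B(Z₁Z₃|Z₀Z₂))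
   − 60·(S₆₂ + S₂₆)`;
* §5 **`kernel_dblFold_bubble_self`** — for `a = b = w` the two colourings of each channel agree WITHOUT exchanging `C₁, C₂`
  (`bubbleSum_swap`: rename the summation labels, `contr` is antisymmetric twice), so
  `kernel (dblFold(Δ_×(C₁)Δ_×(C₂)(w⁰w¹))) 4 Z = −2·4!·(B(Z₂Z₃|Z₀Z₁) + B(Z₀Z₃|Z₁Z₂) − B(Z₀Z₂|Z₁Z₃)) − 120·S₆₂`
  (particle–particle, direct particle–hole, crossed particle–hole; `𝒲₆⊗𝒲₂`).

Generic (commutative `ℚ`-algebra `R`, finite labels `Γ`); proved; no definitions; nothing about the model is asserted.  The model half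
(line tables p495694 + conservation laws p495253 ⇒ one loop sum per channel at the pair labels) is the sequel file.
-/

noncomputable section

namespace Summit.HubbardSuperconductivity.HubbardSuperconductivity.Theorems.KLRegimeWick

set_option linter.dupNamespace false -- summit = problem name (single-conjunct summit), D-0017

open Literature.MathematicalPhysics.QuantumLattice GrassmannAlgebra Finset Matrix

/-! ## §2 The eight odd colourings vanish (copy-`1` sign flip) -/

section Odd

variable (R : Type*) [CommRing R] [Algebra ℚ R] {Γ : Type*} [Fintype Γ] [DecidableEq Γ]

omit [Algebra ℚ R] in
/-- The copy-`1` sign flip fixes copy `0`: `S(dblCopy 0 x) = dblCopy 0 x`. -/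
theorem map_copySign_dblCopy_zero (x : GrassmannAlgebra R Γ) :
    ExteriorAlgebra.map (LinearMap.mulLeft R (fun q : Γ × Fin 2 => if q.2 = 1 then (-1 : R) else 1)) (dblCopy R 0 x) =
      dblCopy R 0 x := by
  have h : (ExteriorAlgebra.map (LinearMap.mulLeft R (fun q : Γ × Fin 2 => if q.2 = 1 then (-1 : R) else 1))).comp
      (dblCopy R (Γ := Γ) 0) = dblCopy R 0 := by
    rw [dblCopy, ExteriorAlgebra.map_comp_map]
    congr 1
    apply LinearMap.ext
    intro v
    funext p
    simp only [LinearMap.comp_apply, LinearMap.mulLeft_apply, Matrix.toLin'_apply, Pi.mul_apply, Matrix.mulVec, dotProduct,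
      dblEmbMat, Matrix.of_apply, ite_mul, one_mul, zero_mul]
    rcases p with ⟨X, s⟩
    by_cases hs : s = 1
    · subst hs; simp
    · simp [hs]
  exact congrArg (fun φ : GrassmannAlgebra R Γ →ₐ[R] GrassmannAlgebra R (Γ × Fin 2) => φ x) h

omit [Algebra ℚ R] in
/-- The copy-`1` sign flip acts on copy `1` as the parity automorphism: `S(dblCopy 1 y) = dblCopy 1 (involute y)`. -/
theorem map_copySign_dblCopy_one (y : GrassmannAlgebra R Γ) :
    ExteriorAlgebra.map (LinearMap.mulLeft R (fun q : Γ × Fin 2 => if q.2 = 1 then (-1 : R) else 1)) (dblCopy R 1 y) =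
      dblCopy R 1 (CliffordAlgebra.involute y) := by
  induction y using ExteriorAlgebra.induction with
  | algebraMap r => simp only [AlgHom.commutes]
  | ι v =>
    rw [involute_ι_eq, map_neg, dblCopy, ExteriorAlgebra.map_apply_ι, ExteriorAlgebra.map_apply_ι, ← map_neg]
    congr 1
    funext p
    simp only [LinearMap.mulLeft_apply, Matrix.toLin'_apply, Pi.mul_apply, Pi.neg_apply, Matrix.mulVec, dotProduct, dblEmbMat,
      Matrix.of_apply, ite_mul, one_mul, zero_mul]
    rcases p with ⟨X, s⟩
    by_cases hs : s = 1
    · subst hs; simp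
    · simp [hs]
  | mul a b ha hb => rw [map_mul, map_mul, ha, hb, map_mul, map_mul]
  | add a b ha hb => rw [map_add, map_add, ha, hb, map_add, map_add]


omit [Fintype Γ] [DecidableEq Γ] [Algebra ℚ R] in
/-- Two derivatives preserve parity. -/
theorem grassmannDeriv_grassmannDeriv_mem_evenOdd (Y Y' : Γ) {i : ZMod 2} {b : GrassmannAlgebra R Γ} (hb : b ∈ evenOdd R i) :
    grassmannDeriv R Y' (grassmannDeriv R Y b) ∈ evenOdd R i := by
  have h := grassmannDeriv_mem_evenOdd R Y' (grassmannDeriv_mem_evenOdd R Y hb)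
  rwa [add_assoc, show (1 : ZMod 2) + 1 = 0 from rfl, add_zero] at h

/-- **A two-copy product with an even copy-`1` factor has no kernel with an odd number of copy-`1` legs.** -/
theorem kernel_copy_mul_copy_eq_zero_of_odd (x : GrassmannAlgebra R Γ) {y : GrassmannAlgebra R Γ} (hy : y ∈ evenOdd R 0) {m : ℕ}
    (W : Fin m → Γ × Fin 2) (hW : ∏ i, (if (W i).2 = 1 then (-1 : R) else 1) = -1) :
    kernel R (dblCopy R 0 x * dblCopy R 1 y) m W = 0 := by
  have hF : ExteriorAlgebra.map (LinearMap.mulLeft R (fun q : Γ × Fin 2 => if q.2 = 1 then (-1 : R) else 1))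
      (dblCopy R 0 x * dblCopy R 1 y) = dblCopy R 0 x * dblCopy R 1 y := by
    rw [map_mul, map_copySign_dblCopy_zero, map_copySign_dblCopy_one, CliffordAlgebra.involute_eq_of_mem_even hy]
  have h : (∏ i, (if (W i).2 = 1 then (-1 : R) else 1)) * kernel R (dblCopy R 0 x * dblCopy R 1 y) m W =
      kernel R (dblCopy R 0 x * dblCopy R 1 y) m W := prod_mul_kernel_of_invariant R _ hF m W
  rw [hW, neg_one_mul] at h
  -- `−k = k` in a `ℚ`-algebra forces `k = 0`
  have h2 : ((Nat.factorial 2 : ℕ) : R) * kernel R (dblCopy R 0 x * dblCopy R 1 y) m W = 0 := by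
    rw [Nat.factorial_two, Nat.cast_ofNat, two_mul]
    nth_rewrite 1 [← h]
    rw [neg_add_cancel]
  exact (isUnit_factorial R 2).mul_right_eq_zero.1 h2

/-- **The two-line term has no kernel at a colouring with an odd number of copy-`1` legs** (`b` even). -/
theorem kernel_bubble_eq_zero_of_odd (C₁ C₂ : Matrix Γ Γ R) (a : GrassmannAlgebra R Γ) {b : GrassmannAlgebra R Γ}
    (hb : b ∈ evenOdd R 0) {m : ℕ} (W : Fin m → Γ × Fin 2) (hW : ∏ i, (if (W i).2 = 1 then (-1 : R) else 1) = -1) :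
    kernel R (grassmannLaplacian R (crossCov R C₁) (grassmannLaplacian R (crossCov R C₂) (dblCopy R 0 a * dblCopy R 1 b))) m W = 0 := by
  rw [grassmannLaplacian_crossCov_crossCov_copy_mul_copy, kernel_neg, neg_eq_zero]
  simp only [kernel_finset_sum, kernel_smul]
  refine Finset.sum_eq_zero fun X _ => Finset.sum_eq_zero fun Y _ => Finset.sum_eq_zero fun X' _ =>
    Finset.sum_eq_zero fun Y' _ => ?_
  rw [kernel_copy_mul_copy_eq_zero_of_odd R _ (grassmannDeriv_grassmannDeriv_mem_evenOdd R Y Y' hb) W hW, mul_zero]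

end Odd

/-! ## §3 The two extreme colourings `(0,0,0,0)` and `(1,1,1,1)`: the `𝒲₆ ⊗ 𝒲₂` graphs -/

section Extreme

variable (R : Type*) [CommRing R] [Algebra ℚ R] {Γ : Type*} [Fintype Γ] [DecidableEq Γ]

omit [Algebra ℚ R] in
/-- All derivatives on copy `0`: `constPart (∂_{(Z,0)} (x⁰·y¹)) = constPart (∂_Z x) · constPart y`. -/
theorem constPart_iterDeriv_copyZero_prod {m : ℕ} (Z : Fin m → Γ) (x y : GrassmannAlgebra R Γ) :
    constPart R (iterDeriv R (fun i => (Z i, (0 : Fin 2))) (dblCopy R 0 x * dblCopy R 1 y)) =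
      constPart R (iterDeriv R Z x) * constPart R y := by
  rw [iterDeriv_copyZero_mul R Z _ (dblCopy_mem_fieldSubalgebra R 1 y), iterDeriv_dblCopy, map_mul, constPart_dblCopy,
    constPart_dblCopy]

omit [Algebra ℚ R] in
/-- All derivatives on copy `1`: `constPart (∂_{(Z,1)} (x⁰·y¹)) = constPart x · constPart (∂_Z y)`. -/
theorem constPart_iterDeriv_copyOne_prod {m : ℕ} (Z : Fin m → Γ) (x y : GrassmannAlgebra R Γ) :
    constPart R (iterDeriv R (fun i => (Z i, (1 : Fin 2))) (dblCopy R 0 x * dblCopy R 1 y)) =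
      constPart R x * constPart R (iterDeriv R Z y) := by
  rw [iterDeriv_copyOne_mul R Z (dblCopy_mem_fieldSubalgebra R 0 x) (dblCopy_mem_fieldSubalgebra R 1 y), iterDeriv_dblCopy, map_mul,
    constPart_dblCopy, involute_iterate_eq]
  split_ifs
  · rw [constPart_dblCopy]
  · rw [involute_dblCopy, constPart_dblCopy, constPart_involute]

omit [Algebra ℚ R] in
/-- The factorials of the extreme colourings: `6!·2! = 4!·60`. -/
theorem factorial_six_mul_two : ((Nat.factorial 6 : ℕ) : R) * ((Nat.factorial 2 : ℕ) : R) = ((Nat.factorial 4 : ℕ) : R) * 60 := by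
  norm_num [Nat.factorial]

/-- **Colouring `(0,0,0,0)`** (all four legs on `a`; two lines to `b`):
`= −60·Σ contr C₂ X Y · contr C₁ X' Y' · kernel a 6 (X,X',Z₀,Z₁,Z₂,Z₃) · kernel b 2 (Y,Y')`. -/
theorem kernel_bubble_colouring_0000 (C₁ C₂ : Matrix Γ Γ R) (a b : GrassmannAlgebra R Γ) (Z : Fin 4 → Γ) :
    kernel R (grassmannLaplacian R (crossCov R C₁) (grassmannLaplacian R (crossCov R C₂) (dblCopy R 0 a * dblCopy R 1 b))) 4
        (fun i => (Z i, (![0, 0, 0, 0] : Fin 4 → Fin 2) i)) =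
      -((60 : R) * ∑ X, ∑ Y, ∑ X', ∑ Y', contr R C₂ X Y * contr R C₁ X' Y' *
        (kernel R a 6 ![X, X', Z 0, Z 1, Z 2, Z 3] * kernel R b 2 ![Y, Y'])) := by
  have hW : (fun i => (Z i, (![0, 0, 0, 0] : Fin 4 → Fin 2) i)) = fun i => (Z i, (0 : Fin 2)) := by
    funext i; fin_cases i <;> rfl
  refine (isUnit_factorial R 4).mul_right_inj.1 ?_
  rw [factorial_mul_kernel, hW, grassmannLaplacian_crossCov_crossCov_copy_mul_copy]
  simp only [map_neg, map_sum, map_smul, smul_eq_mul, constPart_iterDeriv_copyZero_prod, constPart_iterDeriv_four_deriv_deriv,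
    constPart_deriv_deriv, mul_neg, Finset.mul_sum]
  rw [neg_inj]
  refine Finset.sum_congr rfl fun X _ => Finset.sum_congr rfl fun Y _ => Finset.sum_congr rfl fun X' _ =>
    Finset.sum_congr rfl fun Y' _ => ?_
  have h := factorial_six_mul_two R
  linear_combination (contr R C₂ X Y * contr R C₁ X' Y' * (kernel R a 6 ![X, X', Z 0, Z 1, Z 2, Z 3] * kernel R b 2 ![Y, Y'])) * h

/-- **Colouring `(1,1,1,1)`** (all four legs on `b`; two lines to `a`):
`= −60·Σ contr C₂ X Y · contr C₁ X' Y' · kernel a 2 (X,X') · kernel b 6 (Y,Y',Z₀,Z₁,Z₂,Z₃)`. -/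
theorem kernel_bubble_colouring_1111 (C₁ C₂ : Matrix Γ Γ R) (a b : GrassmannAlgebra R Γ) (Z : Fin 4 → Γ) :
    kernel R (grassmannLaplacian R (crossCov R C₁) (grassmannLaplacian R (crossCov R C₂) (dblCopy R 0 a * dblCopy R 1 b))) 4
        (fun i => (Z i, (![1, 1, 1, 1] : Fin 4 → Fin 2) i)) =
      -((60 : R) * ∑ X, ∑ Y, ∑ X', ∑ Y', contr R C₂ X Y * contr R C₁ X' Y' *
        (kernel R a 2 ![X, X'] * kernel R b 6 ![Y, Y', Z 0, Z 1, Z 2, Z 3])) := by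
  have hW : (fun i => (Z i, (![1, 1, 1, 1] : Fin 4 → Fin 2) i)) = fun i => (Z i, (1 : Fin 2)) := by
    funext i; fin_cases i <;> rfl
  refine (isUnit_factorial R 4).mul_right_inj.1 ?_
  rw [factorial_mul_kernel, hW, grassmannLaplacian_crossCov_crossCov_copy_mul_copy]
  simp only [map_neg, map_sum, map_smul, smul_eq_mul, constPart_iterDeriv_copyOne_prod, constPart_iterDeriv_four_deriv_deriv,
    constPart_deriv_deriv, mul_neg, Finset.mul_sum]
  rw [neg_inj]
  refine Finset.sum_congr rfl fun X _ => Finset.sum_congr rfl fun Y _ => Finset.sum_congr rfl fun X' _ =>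
    Finset.sum_congr rfl fun Y' _ => ?_
  have h := factorial_six_mul_two R
  linear_combination (contr R C₂ X Y * contr R C₁ X' Y' * (kernel R a 2 ![X, X'] * kernel R b 6 ![Y, Y', Z 0, Z 1, Z 2, Z 3])) * h

end Extreme

/-! ## §4 All sixteen colourings: the kernel of the folded two-line term -/

section Assembly

variable (R : Type*) [CommRing R] [Algebra ℚ R] {Γ : Type*} [Fintype Γ] [DecidableEq Γ]

/-- **`kernel_dblFold_bubble`** — the `4`-leg kernel of the folded two-line term `dblFold(Δ_×(C₁)(Δ_×(C₂)(a⁰·b¹)))` at labels `Z`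
(`b` even), as the six `2+2` channel colourings and the two `𝒲₆⊗𝒲₂` colourings (the eight odd colourings vanish):
`= −4!·(B(Z₂Z₃|Z₀Z₁) + B(Z₀Z₁|Z₂Z₃) + B(Z₀Z₃|Z₁Z₂) + B(Z₁Z₂|Z₀Z₃) − B(Z₀Z₂|Z₁Z₃) − B(Z₁Z₃|Z₀Z₂)) − 60·(S₆₂ + S₂₆)` with
`B(A₀A₁|B₀B₁) = Σ contr C₂ X Y · contr C₁ X' Y' · kernel a 4 (X,X',A₀,A₁) · kernel b 4 (Y,Y',B₀,B₁)`.  At the pair labels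
`(k′↑+, Q−k′↓+, Q−k↓−, k↑−)`: `{Z₂,Z₃}|{Z₀,Z₁}` = particle–particle, `{Z₀,Z₃}|{Z₁,Z₂}` = direct particle–hole (transfer `k−k′`),
`{Z₀,Z₂}|{Z₁,Z₃}` = crossed particle–hole (transfer `k+k′−Q`). -/
theorem kernel_dblFold_bubble (C₁ C₂ : Matrix Γ Γ R) (a : GrassmannAlgebra R Γ) {b : GrassmannAlgebra R Γ} (hb : b ∈ evenOdd R 0)
    (Z : Fin 4 → Γ) :
    kernel R (dblFold R (grassmannLaplacian R (crossCov R C₁)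
        (grassmannLaplacian R (crossCov R C₂) (dblCopy R 0 a * dblCopy R 1 b)))) 4 Z =
      -((Nat.factorial 4 : R) *
          ((∑ X, ∑ Y, ∑ X', ∑ Y', contr R C₂ X Y * contr R C₁ X' Y' * (kernel R a 4 ![X, X', Z 2, Z 3] * kernel R b 4 ![Y, Y', Z 0, Z 1])) +
           (∑ X, ∑ Y, ∑ X', ∑ Y', contr R C₂ X Y * contr R C₁ X' Y' * (kernel R a 4 ![X, X', Z 0, Z 1] * kernel R b 4 ![Y, Y', Z 2, Z 3])) +
           (∑ X, ∑ Y, ∑ X', ∑ Y', contr R C₂ X Y * contr R C₁ X' Y' * (kernel R a 4 ![X, X', Z 0, Z 3] * kernel R b 4 ![Y, Y', Z 1, Z 2])) +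
           (∑ X, ∑ Y, ∑ X', ∑ Y', contr R C₂ X Y * contr R C₁ X' Y' * (kernel R a 4 ![X, X', Z 1, Z 2] * kernel R b 4 ![Y, Y', Z 0, Z 3])) -
           (∑ X, ∑ Y, ∑ X', ∑ Y', contr R C₂ X Y * contr R C₁ X' Y' * (kernel R a 4 ![X, X', Z 0, Z 2] * kernel R b 4 ![Y, Y', Z 1, Z 3])) -
           (∑ X, ∑ Y, ∑ X', ∑ Y', contr R C₂ X Y * contr R C₁ X' Y' * (kernel R a 4 ![X, X', Z 1, Z 3] * kernel R b 4 ![Y, Y', Z 0, Z 2])))) -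
        (60 : R) *
          ((∑ X, ∑ Y, ∑ X', ∑ Y', contr R C₂ X Y * contr R C₁ X' Y' * (kernel R a 6 ![X, X', Z 0, Z 1, Z 2, Z 3] * kernel R b 2 ![Y, Y'])) +
           (∑ X, ∑ Y, ∑ X', ∑ Y', contr R C₂ X Y * contr R C₁ X' Y' * (kernel R a 2 ![X, X'] * kernel R b 6 ![Y, Y', Z 0, Z 1, Z 2, Z 3]))) := by
  have hodd : ∀ s : Fin 4 → Fin 2, (∏ i, (if ((fun i => (Z i, s i)) i).2 = 1 then (-1 : R) else 1)) = -1 →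
      kernel R (grassmannLaplacian R (crossCov R C₁) (grassmannLaplacian R (crossCov R C₂) (dblCopy R 0 a * dblCopy R 1 b))) 4
        (fun i => (Z i, s i)) = 0 :=
    fun s hs => kernel_bubble_eq_zero_of_odd R C₁ C₂ a hb _ hs
  have h1 : ((1 : Fin 2) = 1) = True := by simp
  have h0 : ((0 : Fin 2) = 1) = False := by simp
  rw [kernel_dblFold, sum_colourings_four, kernel_bubble_colouring_0000, kernel_bubble_colouring_0011, kernel_bubble_colouring_0101,
    kernel_bubble_colouring_0110, kernel_bubble_colouring_1001, kernel_bubble_colouring_1010, kernel_bubble_colouring_1100,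
    kernel_bubble_colouring_1111,
    hodd ![0, 0, 0, 1] (by simp [Fin.prod_univ_four]), hodd ![0, 0, 1, 0] (by simp [Fin.prod_univ_four]),
    hodd ![0, 1, 0, 0] (by simp [Fin.prod_univ_four]), hodd ![1, 0, 0, 0] (by simp [Fin.prod_univ_four]),
    hodd ![0, 1, 1, 1] (by simp [Fin.prod_univ_four]), hodd ![1, 0, 1, 1] (by simp [Fin.prod_univ_four]),
    hodd ![1, 1, 0, 1] (by simp [Fin.prod_univ_four]), hodd ![1, 1, 1, 0] (by simp [Fin.prod_univ_four])]
  ring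

end Assembly

/-! ## §5 Equal vertices `a = b = w`: the two colourings of each channel coincide -/

section Self

variable (R : Type*) [CommRing R] [Algebra ℚ R] {Γ : Type*} [Fintype Γ] [DecidableEq Γ]

omit [DecidableEq Γ] in
/-- **`bubbleSum_swap`** — exchanging the roles of the two copies of the SAME vertex `w` does not change the channel sum and does
NOT exchange `C₁, C₂`: rename the summation labels `X ↔ Y`, `X' ↔ Y'` and use the antisymmetry of `contr` twice. -/
theorem bubbleSum_swap (C₁ C₂ : Matrix Γ Γ R) (w : GrassmannAlgebra R Γ) {m : ℕ} {m' : ℕ} (A : Fin m → Γ) (B : Fin m' → Γ) :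
    (∑ X, ∑ Y, ∑ X', ∑ Y', contr R C₂ X Y * contr R C₁ X' Y' *
        (kernel R w (m + 2) (Matrix.vecCons X (Matrix.vecCons X' A)) * kernel R w (m' + 2) (Matrix.vecCons Y (Matrix.vecCons Y' B)))) =
      ∑ X, ∑ Y, ∑ X', ∑ Y', contr R C₂ X Y * contr R C₁ X' Y' *
        (kernel R w (m' + 2) (Matrix.vecCons X (Matrix.vecCons X' B)) * kernel R w (m + 2) (Matrix.vecCons Y (Matrix.vecCons Y' A))) := by
  rw [Finset.sum_comm]
  refine Finset.sum_congr rfl fun X _ => Finset.sum_congr rfl fun Y _ => ?_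
  rw [Finset.sum_comm]
  refine Finset.sum_congr rfl fun X' _ => Finset.sum_congr rfl fun Y' _ => ?_
  rw [contr_swap R C₂ Y X, contr_swap R C₁ Y' X']
  ring

/-- **`kernel_dblFold_bubble_self`** — for two copies of the same even vertex `w`, the `4`-leg kernel of the folded two-line term is
`−2·4!·(B(Z₂Z₃|Z₀Z₁) + B(Z₀Z₃|Z₁Z₂) − B(Z₀Z₂|Z₁Z₃)) − 120·S₆₂` (pp, ph-direct, ph-crossed; `𝒲₆⊗𝒲₂`). -/
theorem kernel_dblFold_bubble_self (C₁ C₂ : Matrix Γ Γ R) {w : GrassmannAlgebra R Γ} (hw : w ∈ evenOdd R 0) (Z : Fin 4 → Γ) :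
    kernel R (dblFold R (grassmannLaplacian R (crossCov R C₁)
        (grassmannLaplacian R (crossCov R C₂) (dblCopy R 0 w * dblCopy R 1 w)))) 4 Z =
      -(2 * (Nat.factorial 4 : R) *
          ((∑ X, ∑ Y, ∑ X', ∑ Y', contr R C₂ X Y * contr R C₁ X' Y' * (kernel R w 4 ![X, X', Z 2, Z 3] * kernel R w 4 ![Y, Y', Z 0, Z 1])) +
           (∑ X, ∑ Y, ∑ X', ∑ Y', contr R C₂ X Y * contr R C₁ X' Y' * (kernel R w 4 ![X, X', Z 0, Z 3] * kernel R w 4 ![Y, Y', Z 1, Z 2])) -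
           (∑ X, ∑ Y, ∑ X', ∑ Y', contr R C₂ X Y * contr R C₁ X' Y' * (kernel R w 4 ![X, X', Z 0, Z 2] * kernel R w 4 ![Y, Y', Z 1, Z 3])))) -
        (120 : R) *
          (∑ X, ∑ Y, ∑ X', ∑ Y', contr R C₂ X Y * contr R C₁ X' Y' * (kernel R w 6 ![X, X', Z 0, Z 1, Z 2, Z 3] * kernel R w 2 ![Y, Y'])) := by
  rw [kernel_dblFold_bubble R C₁ C₂ w hw Z]
  have e1 := bubbleSum_swap R C₁ C₂ w ![Z 0, Z 1] ![Z 2, Z 3]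
  have e2 := bubbleSum_swap R C₁ C₂ w ![Z 1, Z 2] ![Z 0, Z 3]
  have e3 := bubbleSum_swap R C₁ C₂ w ![Z 1, Z 3] ![Z 0, Z 2]
  have e4 := bubbleSum_swap R C₁ C₂ w (![] : Fin 0 → Γ) ![Z 0, Z 1, Z 2, Z 3]
  simp only [Nat.reduceAdd] at e1 e2 e3 e4
  rw [e1, e2, e3, e4]
  ring

end Self

end Summit.HubbardSuperconductivity.HubbardSuperconductivity.Theorems.KLRegimeWick

end
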